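/-
Copyright (c) 2026. All rights reserved.
Released under Apache 2.0 license as described in the file LICENSE.
Authors: abc-iut cell, fact-proving seat abc-iut-f-073 (block F; FACT-LIST row F-0328 of
abc-iut-L4-t9's `BiAnabelianTelecore.lean`).
-/
import Literature.AnabelianGeometry.AbsoluteAnabelian.AbsTopIII.BiAnabelianTelecoreSchemaNegative
import Literature.AnabelianGeometry.AbsoluteAnabelian.AbsTopIII.BiAnabelianDeltaFamilyProofs

/-!
# [AbsTopIII] Cor 3.7 (ii): kernel verdict on the SCHEMA row `DeltaPinned` (FACT-LIST F-0328)

S. Mochizuki, *Topics in absolute anabelian geometry III* [MochizukiAbsTopIII2015] (kurims manuscript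
`paper:url-5493eb38cbb7`), Cor 3.7 (ii) p. 88: "the collection of natural transformations
`{θ_{□⋎}, θ_{□⋎}⁻¹, θ_⋎, θ_⋎⁻¹}_{⋎ ∈ L}` [...] generate a family of homotopies `ℋ_δ` on `𝒟*`".
PROOF-ONLY companion of `BiAnabelianTelecore.lean` (abc-iut-L4-t9); no `def`, nothing restated.

`BiAnabelianSetting.DeltaPinned 𝔖 θ H` is a PREDICATE on a family of homotopies `H` on `𝒟*` ("`H`
contains the generators of `ℋ_δ` with the printed homotopies": `θ_{□⋎}` the identity, `θ_⋎` the
isomorphism arising from `θ_𝒳`), over an abstract setting `𝔖` and lift datum `θ^bi`.  FACT-LIST rule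
R5: its universal closure is not a fact.  Kernel verdict filed here (the two sibling predicates
`TelePinned` F-0331 / `StarLogPinned` F-0330 received theirs in abc-iut-f-074's
`BiAnabelianTelecoreSchemaNegative.lean`, whose lemmas are reused):

* UNIVERSAL CLOSURE REFUTED, `not_forall_deltaPinned`: at the thin setting of
  `exists_thin_allPinned` (indeed at every setting with a lift datum, `exists_not_deltaPinned`) the
  family with EMPTY boundary set contains no generator pair `([δ_□], [pr_⋎]∘[δ_⋎])`.
* INSTANCE FORM PROVED for every setting and every `θ^bi`, cited: abc-iut-L4-t12's `deltaFamily_pinned`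
  — THE family `ℋ_δ = deltaFamily θ` of the Cor 3.7 (ii) discharge (`BiAnabelianDeltaFamilyProofs.lean`,
  `deltaFamilyStmt_holds`) is `DeltaPinned`; this is the instance at which the predicate is consumed
  (`DeltaFamilyStmt`, `TelecoreDeltaStmt`).
* `deltaPinned_schema_verdict`: both conjuncts, the form the FACT-LIST label «universal-closure
  REFUTED; instance form PROVED» describes.

HONEST FRAMING: statements about the cell's own typing of refereed pre-IUT material over abstract
data; the printed Cor 3.7 (ii) (the MLF data) is neither refuted nor newly proved here; nothing here
bears on [IUTchIII] Cor. 3.12 or takes a side; typed ≠ proved.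
-/

set_option autoImplicit false

namespace Literature.AnabelianGeometry.AbsoluteAnabelian.AbsTopIII.BiAnabelianSetting

open _root_.CategoryTheory

universe u

/-- **F-0328, universal closure REFUTED.**  `DeltaPinned θ K` does not hold for every family `K` on
`𝒟*`: at the thin setting (one exists, with a lift datum `θ^bi`, `exists_thin_allPinned`) the family
with empty boundary set violates it (`exists_not_deltaPinned`) — `DeltaPinned` is a genuine CONDITION
on the family (vocabulary of Cor 3.7 (ii)), not a fact. [cite: MochizukiAbsTopIII2015, Cor 3.7 (ii) p.88] -/
theorem not_forall_deltaPinned :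
    ¬ ∀ {X E N : Type u} [Category.{u} X] [Category.{u} E] [Category.{u} N]
        (𝔖 : BiAnabelianSetting X E N) (θ : FiberSquare.BiAnabelianLift 𝔖.gal)
        (K : 𝔖.starDiagram.HomotopyFamily),
        Literature.AnabelianGeometry.AbsoluteAnabelian.AbsTopIII.BiAnabelianSetting.DeltaPinned 𝔖 θ K := by
  intro h
  obtain ⟨𝔖, θ, -⟩ := exists_thin_allPinned.{u}
  obtain ⟨K, hK⟩ := 𝔖.exists_not_deltaPinned θ
  exact hK (h 𝔖 θ K)

/-- **F-0328, instance form PROVED (every setting, every lift datum; cited)**: the family `ℋ_δ` of the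
Cor 3.7 (ii) discharge (abc-iut-L4-t12's `deltaFamily`, `deltaFamilyStmt_holds`) contains the generators
`θ_{□⋎}`, `θ_⋎` with the printed homotopies — `deltaFamily_pinned`, restated at the FQ type of the row.
[cite: MochizukiAbsTopIII2015, Cor 3.7 (ii) p.88] -/
theorem deltaPinned_deltaFamily {X E N : Type u} [Category.{u} X] [Category.{u} E] [Category.{u} N]
    (𝔖 : BiAnabelianSetting X E N) (θ : FiberSquare.BiAnabelianLift 𝔖.gal) :
    Literature.AnabelianGeometry.AbsoluteAnabelian.AbsTopIII.BiAnabelianSetting.DeltaPinned 𝔖 θ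
      (𝔖.deltaFamily θ) :=
  𝔖.deltaFamily_pinned θ

/-- **F-0328, the printed existence form**: for every setting and lift datum SOME family on `𝒟*` is
`DeltaPinned` (namely `ℋ_δ`). [cite: MochizukiAbsTopIII2015, Cor 3.7 (ii) p.88] -/
theorem exists_deltaPinned {X E N : Type u} [Category.{u} X] [Category.{u} E] [Category.{u} N]
    (𝔖 : BiAnabelianSetting X E N) (θ : FiberSquare.BiAnabelianLift 𝔖.gal) :
    ∃ K : 𝔖.starDiagram.HomotopyFamily,
      Literature.AnabelianGeometry.AbsoluteAnabelian.AbsTopIII.BiAnabelianSetting.DeltaPinned 𝔖 θ K :=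
  ⟨𝔖.deltaFamily θ, 𝔖.deltaFamily_pinned θ⟩

/-- **F-0328, kernel verdict on the schema row** `DeltaPinned`: universal closure refuted AND the
instance form proved for every setting at the family `ℋ_δ` of the Cor 3.7 (ii) discharge.
[cite: MochizukiAbsTopIII2015, Cor 3.7 (ii) p.88] -/
theorem deltaPinned_schema_verdict :
    (¬ ∀ {X E N : Type u} [Category.{u} X] [Category.{u} E] [Category.{u} N]
        (𝔖 : BiAnabelianSetting X E N) (θ : FiberSquare.BiAnabelianLift 𝔖.gal)
        (K : 𝔖.starDiagram.HomotopyFamily),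
        Literature.AnabelianGeometry.AbsoluteAnabelian.AbsTopIII.BiAnabelianSetting.DeltaPinned 𝔖 θ K) ∧
      ∀ {X E N : Type u} [Category.{u} X] [Category.{u} E] [Category.{u} N]
        (𝔖 : BiAnabelianSetting X E N) (θ : FiberSquare.BiAnabelianLift 𝔖.gal),
        Literature.AnabelianGeometry.AbsoluteAnabelian.AbsTopIII.BiAnabelianSetting.DeltaPinned 𝔖 θ
          (𝔖.deltaFamily θ) :=
  ⟨not_forall_deltaPinned.{u}, fun 𝔖 θ => 𝔖.deltaFamily_pinned θ⟩

end Literature.AnabelianGeometry.AbsoluteAnabelian.AbsTopIII.BiAnabelianSetting
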